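import Summits.FinalStateConjecture.FinalStateConjecture.Theorems.EIHFluxBalanceInertialRecessionRechartWhiteHoleEscape
import Summits.FinalStateConjecture.FinalStateConjecture.Theorems.EIHFluxBalanceInertialRecessionRechartStatic
import Summits.FinalStateConjecture.FinalStateConjecture.Theorems.EIHFluxBalanceInertialRecessionStubRechartHorizonGuaranteed
import Literature.Geometry.Lorentzian.CauchyHypersurfaceGlobalHyperbolicity

/-!
# Route EIHFluxBalance — `InertialRecession`, re-charting: painted WHITE HOLES are excluded

Helper file for the crux `stmt-FinalStateConjecture-10166`
(`Summit.FinalStateConjecture.FinalStateConjecture.Theses.EIHFluxBalance.InertialRecession`),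
stub `stub_rechart` of line `sublinear-is-free-clean-window-charges`.

`false_of_antiOrthochronous_hole`: in the `a = 0` lab picture of the crux, a hole painted with an
anti-orthochronous frame (`(Λᵢ(t)e₀)⁰ < 0` for all `t`) is impossible, granted eventual
lab-time causality of the chart (whence (Ofut)), exhaustion (vii), `O = J⁺(Σ) ∩ I⁻(Φ(late painted
exterior))`, and the kinematic limits of hole `i` (`ξ̇ᵢ → V`, lab velocity `→ V`). Proof: along
the escape curve `γ` of `…RechartWhiteHoleEscape` (from inside the painted horizon of hole `i` to
outside it), let `s*` be the first parameter with `γ s* ∈ J⁺(Σ)` (`J⁺(Σ)` is closed for the Cauchy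
hypersurface `Σ = ι(X)`, and the exterior endpoint lies in `Φ(late painted exterior) ⊆ O ⊆ J⁺(Σ)`).
If the painted radius there exceeds `2Mᵢ`, the point lies in the OPEN set `Φ(late painted
exterior) ⊆ J⁺(Σ)` and so do slightly earlier points of `γ` — against minimality. Otherwise the
point is in `J⁺(Σ)` and in `J⁻`, hence `I⁻`, of that open set, i.e. in `O`, and the landed
horizon lemma F1 (`painted_exterior_of_mem_exterior_guaranteed`) puts it OUTSIDE every painted
horizon — against `rᵢ ≤ 2Mᵢ`.

[O'Neill 1983, Ch. 14, Lemma 14.29; folklore]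
-/

noncomputable section

set_option linter.dupNamespace false

open scoped Topology Manifold ContDiff BigOperators
open Set Function Filter Metric Topology TopologicalSpace Literature.Geometry.Lorentzian

namespace Summit.FinalStateConjecture.FinalStateConjecture.Theorems

section Exclusion

variable {X : Type} [TopologicalSpace X] [ChartedSpace E3 X] [IsManifold (𝓡 3) ∞ X]
  [ConnectedSpace X] {D : InitialDataSet (𝓡 3) X}

/-- **`J⁻(W) ⊆ I⁻(W)` for open `W`** (push-up: `z ≤ w ∈ W`, `w ≪ w'` for some `w' ∈ W`, hence
`z ≪ w'`). O'Neill 1983, Ch. 14, Cor. 14.1 and Lemma 14.3. [folklore] -/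
theorem mem_chronologicalPast_of_mem_causalPast_of_isOpen (𝒟 : VacuumCauchyDevelopment D)
    {W : Set 𝒟.carrier} (hW : IsOpen W) {z : 𝒟.carrier}
    (hzW : z ∈ 𝒟.metric.causalPast 𝒟.timeOrientation W) :
    z ∈ 𝒟.metric.chronologicalPast 𝒟.timeOrientation W := by
  have h1 : (1 : ℕ∞ω) ≤ ((⊤ : ℕ∞) : ℕ∞ω) := WithTop.coe_le_coe.mpr le_top
  have hwW : ∀ w ∈ W, w ∈ 𝒟.metric.causalFuture 𝒟.timeOrientation {z} →
      z ∈ 𝒟.metric.chronologicalPast 𝒟.timeOrientation W := by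
    intro w hw hwz
    have hwI : w ∈ 𝒟.metric.chronologicalPast 𝒟.timeOrientation W :=
      subset_chronologicalPast_of_subset_isOpen hW Subset.rfl hw
    unfold LorentzianMetric.chronologicalPast at hwI ⊢
    rw [LorentzianMetric.chronologicalFuture_eq_biUnion] at hwI ⊢
    simp only [mem_iUnion, exists_prop] at hwI ⊢
    obtain ⟨w', hw'W, hww'⟩ := hwI
    refine ⟨w', hw'W, ?_⟩
    have hw'w : w' ∈ 𝒟.metric.chronologicalFuture 𝒟.timeOrientation {w} :=
      LorentzianMetric.mem_chronologicalFuture_of_mem_chronologicalPast hww'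
    exact LorentzianMetric.mem_chronologicalPast_of_mem_chronologicalFuture
      (LorentzianMetric.mem_chronologicalFuture_of_mem_causalFuture h1 hwz hw'w)
  rcases exists_isFutureCausalCurveOn_of_mem_causalPast hzW with hzw | ⟨γ, a, b, hab, hγ, hγa, hγb⟩
  · exact hwW z hzw (LorentzianMetric.subset_causalFuture _ _ _ (mem_singleton z))
  · refine hwW (γ b) hγb ?_
    rw [← hγa]
    exact hγ.apply_mem_causalFuture_apply_left ⟨hab.le, le_rfl⟩

/-- First-parameter bookkeeping (registered helper stub `csInf_mem_of_one_mem_rechart` of the crux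
item): a closed set of reals containing `1` and bounded below by `0` contains its infimum. [folklore] -/
theorem csInf_mem_of_one_mem_rechart : ∀ {A : Set ℝ}, IsClosed A → (1 : ℝ) ∈ A → (∀ s ∈ A, (0 : ℝ) ≤ s) → sInf A ∈ A ∧ ∀ s ∈ A, sInf A ≤ s :=
  fun hA h1 h0 ↦ ⟨hA.csInf_mem ⟨1, h1⟩ ⟨0, h0⟩, fun _ hs ↦ csInf_le ⟨0, h0⟩ hs⟩

-- long statement and bookkeeping proof
set_option maxHeartbeats 800000 in
/-- **Painted white holes are excluded.** See the module docstring. [folklore] -/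
theorem false_of_antiOrthochronous_hole (𝒟 : VacuumCauchyDevelopment D) {N : ℕ} (i : Fin N)
    (M rin : Fin N → ℝ) (Λ : Fin N → ℝ → lorentzGroup) (ξ : Fin N → ℝ → E3)
    (hM : ∀ j, 0 < M j) (hrin : ∀ j, rin j < Kerr.rPlus (M j) 0) {γ : ℝ}
    (hγb : ∀ j t, |((Λ j t : E4 ≃L[ℝ] E4) (E4.basisVector 0)) 0| ≤ γ)
    (hΛc : ∀ j, Continuous fun t ↦ ((Λ j t : E4 ≃L[ℝ] E4) : E4 →L[ℝ] E4))
    (hξc : ∀ j, Continuous (ξ j)) (hξd : Differentiable ℝ (ξ i)) {V : E3} (hV : ‖V‖ < 1)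
    (hξV : Tendsto (deriv (ξ i)) atTop (𝓝 V))
    (hneg : ∀ t, ((Λ i t : E4 ≃L[ℝ] E4) (E4.basisVector 0)) 0 < 0)
    (hv : Tendsto (fun t ↦ (((Λ i t : E4 ≃L[ℝ] E4) (E4.basisVector 0)) 0)⁻¹ •
      E4.spatial ((Λ i t : E4 ≃L[ℝ] E4) (E4.basisVector 0))) atTop (𝓝 V))
    (hsep : ∀ j, j ≠ i → Tendsto (fun t ↦ ‖ξ i t - ξ j t‖) atTop atTop)
    (U : Opens E4) (Φ : U → 𝒟.carrier) (hΦ : ContMDiff 𝓘(ℝ, E4) (𝓡 4) ∞ Φ) {τ₀ : ℝ}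
    (hU : {x : E4 | τ₀ < x 0 ∧ ∀ j, rin j < Kerr.radius 0 (poincareInv (Λ j (x 0))
      (E4.ofTimeSpace (x 0) (ξ j (x 0))) x)} ⊆ (U : Set E4))
    (hembΦ : IsOpenEmbedding (({x : U | τ₀ < x.1 0} : Set U).restrict Φ))
    {k : ℕ} (hdev : Tendsto (fun t ↦ 𝒟.toSpacetime.deviationCk ⟨U, fun x ↦ Minkowski.bilin +
      ∑ j, (boostedKerrBilin (Λ j (x 0)) (E4.ofTimeSpace (x 0) (ξ j (x 0))) (M j) 0 x -
        Minkowski.bilin), fun x ↦ x 0, E4.spatialNorm⟩ Φ k t) atTop (𝓝 0))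
    (O : Set 𝒟.carrier)
    (hO : O = 𝒟.metric.causalFuture 𝒟.timeOrientation (range 𝒟.embed) ∩
      𝒟.metric.chronologicalPast 𝒟.timeOrientation (Φ '' {x : U | τ₀ < x.1 0 ∧ ∀ j,
        Kerr.rPlus (M j) 0 < Kerr.radius 0 (poincareInv (Λ j (x.1 0))
          (E4.ofTimeSpace (x.1 0) (ξ j (x.1 0))) x.1)}))
    (himO : Φ '' {x : U | τ₀ < x.1 0 ∧ ∀ j, Kerr.rPlus (M j) 0 < Kerr.radius 0
      (poincareInv (Λ j (x.1 0)) (E4.ofTimeSpace (x.1 0) (ξ j (x.1 0))) x.1)} ⊆ O)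
    (hexh : ∀ t₁ : ℝ, τ₀ < t₁ → O \ Φ '' {x : U | t₁ < x.1 0 ∧ ∀ j, Kerr.rPlus (M j) 0 <
      Kerr.radius 0 (poincareInv (Λ j (x.1 0)) (E4.ofTimeSpace (x.1 0) (ξ j (x.1 0))) x.1)} ⊆
      𝒟.metric.causalPast 𝒟.timeOrientation (Φ '' {x : U | x.1 0 = t₁ ∧ ∀ j, Kerr.rPlus (M j) 0 <
        Kerr.radius 0 (poincareInv (Λ j (x.1 0)) (E4.ofTimeSpace (x.1 0) (ξ j (x.1 0))) x.1)}))
    {τ₁ : ℝ}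
    (hT : ∀ x y : U, (τ₁ < x.1 0 ∧ ∀ j, rin j < Kerr.radius 0 (poincareInv (Λ j (x.1 0))
      (E4.ofTimeSpace (x.1 0) (ξ j (x.1 0))) x.1)) → (τ₁ < y.1 0 ∧ ∀ j, rin j <
      Kerr.radius 0 (poincareInv (Λ j (y.1 0)) (E4.ofTimeSpace (y.1 0) (ξ j (y.1 0))) y.1)) →
      Φ y ∈ 𝒟.metric.causalFuture 𝒟.timeOrientation {Φ x} → x.1 0 ≤ y.1 0)
    {TO : ℝ}
    (hOfut : ∀ x : U, TO < x.1 0 → (∀ j, rin j < Kerr.radius 0 (poincareInv (Λ j (x.1 0))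
      (E4.ofTimeSpace (x.1 0) (ξ j (x.1 0))) x.1)) → ∀ w : E4, 0 < w 0 →
      𝒟.metric.val (Φ x) (mfderiv 𝓘(ℝ, E4) (𝓡 4) Φ x w) (mfderiv 𝓘(ℝ, E4) (𝓡 4) Φ x w) < 0 →
        𝒟.timeOrientation.IsFutureDirected (mfderiv 𝓘(ℝ, E4) (𝓡 4) Φ x w)) : False := by
  have hrp2 : ∀ j, Kerr.rPlus (M j) 0 = 2 * M j := fun j ↦ Kerr.rPlus_zero_right (hM j).le
  have hrin2 : rin i < 2 * M i := by rw [← hrp2]; exact hrin i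
  obtain ⟨xs, hxsU, hcurve, hpts, hstart, hend⟩ := exists_escape_curve i M rin
    (fun j ↦ Kerr.rPlus (M j) 0) Λ ξ (hM i) hrin2 hγb hΛc hξc hξd hV hξV hneg hv hsep U Φ hΦ hU
    hdev hOfut (max τ₀ τ₁)
  -- notation
  set rp : Fin N → U → ℝ := fun j x ↦ Kerr.radius 0 (poincareInv (Λ j (x.1 0))
    (E4.ofTimeSpace (x.1 0) (ξ j (x.1 0))) x.1) with hrp
  set W : Set 𝒟.carrier := Φ '' {x : U | τ₀ < x.1 0 ∧ ∀ j, Kerr.rPlus (M j) 0 < rp j x} with hW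
  have hrpc : ∀ j, Continuous (rp j) := fun j ↦
    (continuous_paintedRadius 0 (Λ j) (ξ j) (hΛc j) (hξc j)).comp continuous_subtype_val
  have hWo : IsOpen W := isOpen_image_late_of_continuous hembΦ rp hrpc fun j ↦ Kerr.rPlus (M j) 0
  set S : Set 𝒟.carrier := range 𝒟.embed with hS
  have hSC := 𝒟.isCauchyHypersurface
  have h2 : (2 : ℕ∞ω) ≤ ((⊤ : ℕ∞) : ℕ∞ω) := WithTop.coe_le_coe.mpr le_top
  have hWJ : W ⊆ 𝒟.metric.causalFuture 𝒟.timeOrientation S := by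
    intro z hz
    have := himO hz
    rw [hO] at this
    exact this.1
  -- facts along the curve
  have hlateσ : ∀ σ, τ₀ < xs σ 0 ∧ τ₁ < xs σ 0 := fun σ ↦
    ⟨(le_max_left _ _).trans_lt (hpts σ).1, (le_max_right _ _).trans_lt (hpts σ).1⟩
  have hWmem : ∀ σ, 2 * M i < rp i ⟨xs σ, hxsU σ⟩ → Φ ⟨xs σ, hxsU σ⟩ ∈ W := by
    intro σ hσ
    refine ⟨⟨xs σ, hxsU σ⟩, ⟨(hlateσ σ).1, fun j ↦ ?_⟩, rfl⟩
    by_cases hj : j = i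
    · subst hj; rw [hrp2]; exact hσ
    · exact (hpts σ).2.2 j hj
  have hend' : 2 * M i < rp i ⟨xs 1, hxsU 1⟩ := hend
  have hstart' : rp i ⟨xs 0, hxsU 0⟩ < 2 * M i := hstart
  -- the first parameter in `J⁺(S)`
  have hγc : ContinuousOn (fun σ ↦ Φ ⟨xs σ, hxsU σ⟩) (Icc 0 1) :=
    continuousOn_of_isFutureCausalCurveOn hcurve
  set A : Set ℝ := Icc 0 1 ∩ (fun σ ↦ Φ ⟨xs σ, hxsU σ⟩) ⁻¹' 𝒟.metric.causalFuture 𝒟.timeOrientation S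
    with hA
  have hAc : IsClosed A :=
    hγc.preimage_isClosed_of_isClosed isClosed_Icc (hSC.isClosed_causalFuture_set h2)
  have h1A : (1 : ℝ) ∈ A := ⟨⟨zero_le_one, le_rfl⟩, hWJ (hWmem 1 hend')⟩
  have hbdd : BddBelow A := ⟨0, fun s hs ↦ hs.1.1⟩
  set s₀ : ℝ := sInf A with hs₀
  have hs₀A : s₀ ∈ A := hAc.csInf_mem ⟨1, h1A⟩ hbdd
  have hs₀I : s₀ ∈ Icc (0 : ℝ) 1 := hs₀A.1
  have hbefore : ∀ s ∈ Icc (0 : ℝ) 1, s < s₀ →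
      Φ ⟨xs s, hxsU s⟩ ∉ 𝒟.metric.causalFuture 𝒟.timeOrientation S := fun s hs hlt hJ ↦
    (not_le.mpr hlt) (csInf_le hbdd ⟨hs, hJ⟩)
  rcases lt_or_ge (2 * M i) (rp i ⟨xs s₀, hxsU s₀⟩) with hext | hint
  · -- exterior at `s₀`: earlier points are exterior too, against minimality
    have hs₀pos : 0 < s₀ := by
      rcases eq_or_lt_of_le hs₀I.1 with h | h
      · exfalso
        have h' : xs s₀ = xs 0 := by rw [← h]
        have : rp i ⟨xs s₀, hxsU s₀⟩ = rp i ⟨xs 0, hxsU 0⟩ := by simp only [hrp, h']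
        linarith
      · exact h
    have hWs : Φ ⟨xs s₀, hxsU s₀⟩ ∈ W := hWmem s₀ hext
    have hnhds : (fun σ ↦ Φ ⟨xs σ, hxsU σ⟩) ⁻¹' W ∈ 𝓝[Icc 0 1] s₀ :=
      (hγc.continuousWithinAt hs₀I) (hWo.mem_nhds hWs)
    obtain ⟨η, hη, hηP⟩ := Metric.mem_nhdsWithin_iff.mp hnhds
    set s : ℝ := max 0 (s₀ - η / 2) with hs
    have hsI : s ∈ Icc (0 : ℝ) 1 := ⟨le_max_left _ _, by
      rw [hs]; exact max_le zero_le_one (by linarith [hs₀I.2])⟩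
    have hslt : s < s₀ := by rw [hs]; exact max_lt hs₀pos (by linarith)
    have hsdist : s ∈ ball s₀ η := by
      rw [mem_ball, Real.dist_eq, abs_lt]
      have : s₀ - η / 2 ≤ s := le_max_right _ _
      constructor <;> linarith
    have hsW : Φ ⟨xs s, hxsU s⟩ ∈ W := hηP ⟨hsdist, hsI⟩
    exact hbefore s hsI hslt (hWJ hsW)
  · -- interior-or-horizon at `s₀`: the point is in `O`, against the horizon lemma F1
    have hJW : Φ ⟨xs s₀, hxsU s₀⟩ ∈ 𝒟.metric.causalPast 𝒟.timeOrientation W :=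
      mem_causalPast_of_curve (hcurve.mono (Icc_subset_Icc hs₀I.1 le_rfl)) ⟨hs₀I.2, le_rfl⟩
        (hWmem 1 hend')
    have hIW := mem_chronologicalPast_of_mem_causalPast_of_isOpen 𝒟 hWo hJW
    have hO' : Φ ⟨xs s₀, hxsU s₀⟩ ∈ O := by rw [hO]; exact ⟨hs₀A.2, hIW⟩
    have hinj : InjOn Φ {x : U | τ₀ < x.1 0} := by
      intro x hx y hy hxy
      have h := hembΦ.injective (a₁ := ⟨x, hx⟩) (a₂ := ⟨y, hy⟩) hxy
      exact congrArg Subtype.val h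
    have hF1 := SublinearIsFree.Rechart.painted_exterior_of_mem_exterior_guaranteed 𝒟 M (fun _ ↦ (0 : ℝ))
      rin Λ ξ τ₀ τ₁ U Φ O
      hrin hinj hexh hT ⟨xs s₀, hxsU s₀⟩ (hlateσ s₀).1 (hlateσ s₀).2 (hpts s₀).2.1 hO' i
    have hF1' : Kerr.rPlus (M i) 0 < rp i ⟨xs s₀, hxsU s₀⟩ := hF1
    rw [hrp2] at hF1'
    linarith

end Exclusion

end Summit.FinalStateConjecture.FinalStateConjecture.Theorems
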